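import Summits.Ventures.PercRepro.RankLevelSetLevelSixHeavyCellSq28C
import Summits.Ventures.PercRepro.RankLevelSetCoreCircuitBounds
import Summits.Ventures.PercRepro.RankLevelSetLevelSixArithHeavySq28CA
import Summits.Ventures.PercRepro.RankLevelSetLevelSixArithHeavySq28CB
import Summits.Ventures.PercRepro.RankLevelSetLevelSixArithHeavySq28CC
import Summits.Ventures.PercRepro.RankLevelSetLevelSixArithHeavySq28CD
import Summits.Ventures.PercRepro.RankLevelSetLevelSixArithHeavySq28CE
import Summits.Ventures.PercRepro.RankLevelSetLevelSixArithHeavySq28CF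
import Summits.Ventures.PercRepro.RankLevelSetLevelSixArithHeavySq28CG
import Summits.Ventures.PercRepro.RankLevelSetLevelSixArithHeavySq28CH
import Summits.Ventures.PercRepro.RankLevelSetLevelSixArithHeavySq28CI
import Summits.Ventures.PercRepro.RankLevelSetLevelSixArithHeavySq28CJ
import Summits.Ventures.PercRepro.RankLevelSetLevelSixArithHeavySq28CK
import Summits.Ventures.PercRepro.RankLevelSetLevelSixArithHeavySq28CL
import Summits.Ventures.PercRepro.RankLevelSetLevelSixArithHeavySq28CM
import Summits.Ventures.PercRepro.TriangleCapEightI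
import Summits.Ventures.PercRepro.S1CoreCapUncond
import Summits.Ventures.PercRepro.RankLevelSetFourCircuitAvgExt
import Summits.Ventures.PercRepro.RankLevelSetFiveCircuitAvg
import Summits.Ventures.PercRepro.S1TrianglePlusSharp
import Summits.Ventures.PercRepro.S1CoreFourCircuitSum


/-!
# PercRepro — THEOREM C₆ WITH THE CUBIC MULTIPLICITY, THE DISJOINT PAIR COUNT, THE WINDOWED HEAVY TERM AND THE CIRCUIT TABLES: LEVEL `5` AT `27` ⇒ C-025 AT
LEVEL `6` FOR EVERY `p ≥ 28`, AND `c025_six_large_twenty_eight (28 ≤ p) : RLS M p 6` UNCONDITIONAL (p8 g6, S3)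

`proofs/SUBCLAIM-S3-p8.md` §3s. The level-`6` row on the cell theorem `c025_core_six_heavy_cell_sq28c` (RankLevelSetLevelSixHeavyCellSq28C: flat bounds
`39 / 19`, p4's CUBIC MULTIPLICITY — fibre weights `1/cube(j + 1)`, `cube ν = ν(ν² + 1)/2` = `1, 1/5, 1/15, 1/34, 1/65, …` (RankLevelSetMultCubeCount on
`S2.card_pairs_ge_cube`), rational tails in the level-by-level form (the crude form at `d = 15`), THE WINDOWED HEAVY TERM, THE DISJOINT PAIR COUNT
`P(n) = s₃·C(n − 3, 4) + s₄·C(n − 4, 3) + s₅·C(n − 5, 2) + s₆·(n − 6) + s₇` with `s₃ ≤ c3`, `s₄ ≤ c4`, `s₅ ≤ c5` as hypotheses), with the circuit bounds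
p3's `cq3` table (`s₃ ≤ cq3 d` at `d ≤ 29`, TriangleCapEightI), p1's LEMMA T⁺⁺⁺ (`s₃ ≤ (d² − 3d + 6)/2` beyond, S1TrianglePlusSharp), p1's unconditional `s₄ ≤ 85 / 122` at `d = 7 / 8` (S1CoreCapUncond) with the averaging recursion `170 / 231 / 308 / 402` at `d = 9 … 12` (RankLevelSetFourCircuitAvgExt) and the 4-circuit table beyond (S1CoreFourCircuitSum), the 5-circuit averaging table `432 / 702 / 1092 / 1638 / 2382 / 3374` at `d = 7 … 12` (RankLevelSetFiveCircuitAvg) and the crude `C(d + 4, 5)` beyond. Every core cell `(p, 7 ≤ d ≤ 51)` at `p ≥ 28` by the cell theorem with the per-corank parameters of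
RankLevelSetLevelSixArithHeavySq28CA … W (`c025_core_six_bounded_corank_heavy_sq28c`); the cells `d ≥ 52` by
`c025_core_six_thirtynine_twenty_eight'` (RankLevelSetCoreSixLowSelfDG: the regime-II cells with the cube count up to `n = 91` and the corank key from `n₀ = 92`); level `5` for
`p ≥ 27` gives level `6` for `p ≥ 28` (`c025_six_of_five_heavy_sq28c`: rank `28` by `rls_six_at_of_core`, ranks `≥ 29` by
`rls_succ_large`). The UNCONDITIONAL row `c025_six_large_twenty_eight (28 ≤ p)` follows in RankLevelSetLevelSixHeavySq28CAll the minute a level-`5` row from `27` is in the tree (p7's `c025_five_large_three30` / the sharp chain). Axioms: standard.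
-/

open scoped Matroid

namespace PercRepro

namespace ThmN

open Set

variable {α : Type}

/-- **The `e`-free core at level `6`, corank `7 ≤ d ≤ 31`, rank `p ≥ 28`** (the cell theorem `c025_core_six_heavy_cell_sq28c` with the per-corank parameters of the parts; circuit bounds: p3's `cq3` table (`s₃ ≤ cq3 d` at `d ≤ 29`, TriangleCapEightI), p1's LEMMA T⁺⁺⁺ (`s₃ ≤ (d² − 3d + 6)/2` beyond, S1TrianglePlusSharp), p1's unconditional `s₄ ≤ 85 / 122` at `d = 7 / 8` (S1CoreCapUncond) with the averaging recursion `170 / 231 / 308 / 402` at `d = 9 … 12` (RankLevelSetFourCircuitAvgExt) and the 4-circuit table beyond (S1CoreFourCircuitSum), the 5-circuit averaging table `432 / 702 / 1092 / 1638 / 2382 / 3374` at `d = 7 … 12` (RankLevelSetFiveCircuitAvg) and the crude `C(d + 4, 5)` beyond). -/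
theorem c025_core_six_bounded_corank_heavy_sq28c_lo (M : Matroid α) [M.Finite] (p d : ℕ) (hp : 28 ≤ p) (hd7 : 7 ≤ d) (hd31 : d ≤ 31)
    (hR : M.eRank = (p : ℕ∞)) (hn : M.E.ncard = p + d)
    (hfree : ∀ e ∈ M.E, ∃ A ⊆ M.E \ {e}, e ∉ M.closure A ∧ e ∉ M.closure ((M.E \ {e}) \ A)) :
    RLS M p 6 := by
  have hd : M.E.encard = M.eRank + d := by
    rw [hR, ← M.ground_finite.cast_ncard_eq, hn]
    push_cast
    ring
  have hL : ∀ e ∈ M.E, ¬ M.IsLoop e := not_isLoop_of_free M hfree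
  have hs : ∀ e ∈ M.E, ∀ f ∈ M.E, e ≠ f → M.eRk {e, f} = 2 := by
    intro e he f hf hef
    have h2 : (2 : ℕ∞) ≤ M.eRk {e, f} :=
      two_le_eRk_of_two_le_ncard_of_free M hfree (pair_subset he hf) (by rw [ncard_pair hef])
    have h3 : M.eRk {e, f} ≤ 2 := by
      have := M.eRk_le_encard {e, f}
      rwa [encard_pair hef] at this
    exact le_antisymm h3 h2
  have hC1 : ∀ L ⊆ M.E, M.eRk L = 2 → L.ncard ≤ 3 :=
    fun L hL hr => ncard_le_three_of_eRk_two M hs hfree hL hr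
  have hC2 : ∀ P ⊆ M.E, M.eRk P ≤ 3 → P.ncard ≤ 6 :=
    fun P hP hr => ncard_le_six_of_eRk_le_three_of_free M hfree hP hr
  interval_cases d
  · exact c025_core_six_heavy_cell_sq28c M p 7 7 1 1 13 12 0 1413340 1000 13 432 85 11
      (by norm_num) (by norm_num) (by norm_num) (by norm_num) (by norm_num) (by norm_num)
      (by norm_num [cnull]) (by norm_num [cnull]) (Or.inl (by norm_num)) (Or.inl (by norm_num)) (Or.inl (by norm_num)) (by norm_num) (by norm_num) (by norm_num)
      ((TriangleCap.core_ncard_triangles_le_cq3 M hfree hd).trans (by decide))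
      (S1.ncard_fourCircuits_le_eighty_five_uncond M hfree hd)
      (ncard_fiveCircuits_le_four_thirty_two M hfree hd)
      (Or.inl (tail_six_heavy_sq28C_7 p hp)) hR hn hfree (level_six_poly_heavy_sq28C_7 p hp)
  · exact c025_core_six_heavy_cell_sq28c M p 8 7 2 1 16 14 0 1030985 1000 14 702 122 13
      (by norm_num) (by norm_num) (by norm_num) (by norm_num) (by norm_num) (by norm_num)
      (by norm_num [cnull]) (by norm_num [cnull]) (Or.inl (by norm_num)) (Or.inl (by norm_num)) (Or.inl (by norm_num)) (by norm_num) (by norm_num) (by norm_num)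
      ((TriangleCap.core_ncard_triangles_le_cq3 M hfree hd).trans (by decide))
      (S1.ncard_fourCircuits_le_one_twenty_two_uncond M hfree hd)
      (ncard_fiveCircuits_le_seven_oh_two M hfree hd)
      (Or.inl (tail_six_heavy_sq28C_8 p hp)) hR hn hfree (level_six_poly_heavy_sq28C_8 p hp)
  · exact c025_core_six_heavy_cell_sq28c M p 9 7 2 1 19 16 0 631350 1000 15 1092 170 16
      (by norm_num) (by norm_num) (by norm_num) (by norm_num) (by norm_num) (by norm_num)
      (by norm_num [cnull]) (by norm_num [cnull]) (Or.inl (by norm_num)) (Or.inl (by norm_num)) (Or.inl (by norm_num)) (by norm_num) (by norm_num) (by norm_num)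
      ((TriangleCap.core_ncard_triangles_le_cq3 M hfree hd).trans (by decide))
      (ncard_fourCircuits_le_one_seventy_uncond M hfree hd)
      (ncard_fiveCircuits_le_ten_ninety_two M hfree hd)
      (Or.inl (tail_six_heavy_sq28C_9 p hp)) hR hn hfree (level_six_poly_heavy_sq28C_9 p hp)
  · exact c025_core_six_heavy_cell_sq28c M p 10 7 2 1 22 18 0 356124 1000 16 1638 231 20
      (by norm_num) (by norm_num) (by norm_num) (by norm_num) (by norm_num) (by norm_num)
      (by norm_num [cnull]) (by norm_num [cnull]) (Or.inl (by norm_num)) (Or.inl (by norm_num)) (Or.inl (by norm_num)) (by norm_num) (by norm_num) (by norm_num)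
      ((TriangleCap.core_ncard_triangles_le_cq3 M hfree hd).trans (by decide))
      (ncard_fourCircuits_le_two_thirty_one_uncond M hfree hd)
      (ncard_fiveCircuits_le_sixteen_thirty_eight M hfree hd)
      (Or.inl (tail_six_heavy_sq28C_10 p hp)) hR hn hfree (level_six_poly_heavy_sq28C_10 p hp)
  · exact c025_core_six_heavy_cell_sq28c M p 11 8 2 1 23 19 0 202162 1000 17 2382 308 24
      (by norm_num) (by norm_num) (by norm_num) (by norm_num) (by norm_num) (by norm_num)
      (by norm_num [cnull]) (by norm_num [cnull]) (Or.inl (by norm_num)) (Or.inl (by norm_num)) (Or.inl (by norm_num)) (by norm_num) (by norm_num) (by norm_num)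
      ((TriangleCap.core_ncard_triangles_le_cq3 M hfree hd).trans (by decide))
      (ncard_fourCircuits_le_three_oh_eight_uncond M hfree hd)
      (ncard_fiveCircuits_le_twenty_three_eighty_two M hfree hd)
      (Or.inl (tail_six_heavy_sq28C_11 p hp)) hR hn hfree (level_six_poly_heavy_sq28C_11 p hp)
  · exact c025_core_six_heavy_cell_sq28c M p 12 10 1 1 20 17 0 118571 1000 18 3374 402 29
      (by norm_num) (by norm_num) (by norm_num) (by norm_num) (by norm_num) (by norm_num)
      (by norm_num [cnull]) (by norm_num [cnull]) (Or.inl (by norm_num)) (Or.inr (Or.inl ⟨by norm_num, by norm_num⟩)) (Or.inl (by norm_num)) (by norm_num) (by norm_num) (by norm_num)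
      ((TriangleCap.core_ncard_triangles_le_cq3 M hfree hd).trans (by decide))
      (ncard_fourCircuits_le_four_oh_two_uncond M hfree hd)
      (ncard_fiveCircuits_le_thirty_three_seventy_four M hfree hd)
      (Or.inl (tail_six_heavy_sq28C_12 p hp)) hR hn hfree (level_six_poly_heavy_sq28C_12 p hp)
  · exact c025_core_six_heavy_cell_sq28c M p 13 10 1 1 22 18 0 72057 1000 19 6188 658 34
      (by norm_num) (by norm_num) (by norm_num) (by norm_num) (by norm_num) (by norm_num)
      (by norm_num [cnull]) (by norm_num [cnull]) (Or.inl (by norm_num)) (Or.inr (Or.inl ⟨by norm_num, by norm_num⟩)) (Or.inl (by norm_num)) (by norm_num) (by norm_num) (by norm_num)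
      ((TriangleCap.core_ncard_triangles_le_cq3 M hfree hd).trans (by decide))
      ((S1.ncard_fourCircuits_le_fourCircuitBound M hfree hd).trans (by decide +kernel))
      ((Matroid.ncard_circuits_le_choose_of_encard M hd 4).trans (by decide +kernel))
      (Or.inl (tail_six_heavy_sq28C_13 p hp)) hR hn hfree (level_six_poly_heavy_sq28C_13 p hp)
  · exact c025_core_six_heavy_cell_sq28c M p 14 11 1 1 23 19 0 45724 1000 20 8568 812 40
      (by norm_num) (by norm_num) (by norm_num) (by norm_num) (by norm_num) (by norm_num)
      (by norm_num [cnull]) (by norm_num [cnull]) (Or.inl (by norm_num)) (Or.inr (Or.inl ⟨by norm_num, by norm_num⟩)) (Or.inl (by norm_num)) (by norm_num) (by norm_num) (by norm_num)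
      ((TriangleCap.core_ncard_triangles_le_cq3 M hfree hd).trans (by decide))
      ((S1.ncard_fourCircuits_le_fourCircuitBound M hfree hd).trans (by decide +kernel))
      ((Matroid.ncard_circuits_le_choose_of_encard M hd 4).trans (by decide +kernel))
      (Or.inl (tail_six_heavy_sq28C_14 p hp)) hR hn hfree (level_six_poly_heavy_sq28C_14 p hp)
  · exact c025_core_six_heavy_cell_sq28c M p 15 11 1 1 25 19 0 1876 1000 21 11628 988 47
      (by norm_num) (by norm_num) (by norm_num) (by norm_num) (by norm_num) (by norm_num)
      (by norm_num [cnull]) (by norm_num [cnull]) (Or.inl (by norm_num)) (Or.inr (Or.inl ⟨by norm_num, by norm_num⟩)) (Or.inl (by norm_num)) (by norm_num) (by norm_num) (by norm_num)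
      ((TriangleCap.core_ncard_triangles_le_cq3 M hfree hd).trans (by decide))
      ((S1.ncard_fourCircuits_le_fourCircuitBound M hfree hd).trans (by decide +kernel))
      ((Matroid.ncard_circuits_le_choose_of_encard M hd 4).trans (by decide +kernel))
      (Or.inr (tail_six_heavy_sq28C_15 (p + 15) (by omega))) hR hn hfree (level_six_poly_heavy_sq28C_15 p hp)
  · exact c025_core_six_heavy_cell_sq28c M p 16 12 1 1 26 19 0 20780 1000 22 15504 1188 54
      (by norm_num) (by norm_num) (by norm_num) (by norm_num) (by norm_num) (by norm_num)
      (by norm_num [cnull]) (by norm_num [cnull]) (Or.inl (by norm_num)) (Or.inr (Or.inl ⟨by norm_num, by norm_num⟩)) (Or.inl (by norm_num)) (by norm_num) (by norm_num) (by norm_num)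
      ((TriangleCap.core_ncard_triangles_le_cq3 M hfree hd).trans (by decide))
      ((S1.ncard_fourCircuits_le_fourCircuitBound M hfree hd).trans (by decide +kernel))
      ((Matroid.ncard_circuits_le_choose_of_encard M hd 4).trans (by decide +kernel))
      (Or.inl (tail_six_heavy_sq28C_16 p hp)) hR hn hfree (level_six_poly_heavy_sq28C_16 p hp)
  · exact c025_core_six_heavy_cell_sq28c M p 17 12 1 1 28 19 0 14789 1000 23 20349 1413 62
      (by norm_num) (by norm_num) (by norm_num) (by norm_num) (by norm_num) (by norm_num)
      (by norm_num [cnull]) (by norm_num [cnull]) (Or.inl (by norm_num)) (Or.inr (Or.inl ⟨by norm_num, by norm_num⟩)) (Or.inl (by norm_num)) (by norm_num) (by norm_num) (by norm_num)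
      ((TriangleCap.core_ncard_triangles_le_cq3 M hfree hd).trans (by decide))
      ((S1.ncard_fourCircuits_le_fourCircuitBound M hfree hd).trans (by decide +kernel))
      ((Matroid.ncard_circuits_le_choose_of_encard M hd 4).trans (by decide +kernel))
      (Or.inl (tail_six_heavy_sq28C_17 p hp)) hR hn hfree (level_six_poly_heavy_sq28C_17 p hp)
  · exact c025_core_six_heavy_cell_sq28c M p 18 13 1 1 29 19 0 10869 1000 24 26334 1665 71
      (by norm_num) (by norm_num) (by norm_num) (by norm_num) (by norm_num) (by norm_num)
      (by norm_num [cnull]) (by norm_num [cnull]) (Or.inl (by norm_num)) (Or.inr (Or.inl ⟨by norm_num, by norm_num⟩)) (Or.inl (by norm_num)) (by norm_num) (by norm_num) (by norm_num)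
      ((TriangleCap.core_ncard_triangles_le_cq3 M hfree hd).trans (by decide))
      ((S1.ncard_fourCircuits_le_fourCircuitBound M hfree hd).trans (by decide +kernel))
      ((Matroid.ncard_circuits_le_choose_of_encard M hd 4).trans (by decide +kernel))
      (Or.inl (tail_six_heavy_sq28C_18 p hp)) hR hn hfree (level_six_poly_heavy_sq28C_18 p hp)
  · exact c025_core_six_heavy_cell_sq28c M p 19 13 1 1 31 19 0 8229 1000 25 33649 1945 81
      (by norm_num) (by norm_num) (by norm_num) (by norm_num) (by norm_num) (by norm_num)
      (by norm_num [cnull]) (by norm_num [cnull]) (Or.inl (by norm_num)) (Or.inr (Or.inl ⟨by norm_num, by norm_num⟩)) (Or.inl (by norm_num)) (by norm_num) (by norm_num) (by norm_num)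
      ((TriangleCap.core_ncard_triangles_le_cq3 M hfree hd).trans (by decide))
      ((S1.ncard_fourCircuits_le_fourCircuitBound M hfree hd).trans (by decide +kernel))
      ((Matroid.ncard_circuits_le_choose_of_encard M hd 4).trans (by decide +kernel))
      (Or.inl (tail_six_heavy_sq28C_19 p hp)) hR hn hfree (level_six_poly_heavy_sq28C_19 p hp)
  · exact c025_core_six_heavy_cell_sq28c M p 20 14 1 1 32 19 0 6402 1000 26 42504 2255 92
      (by norm_num) (by norm_num) (by norm_num) (by norm_num) (by norm_num) (by norm_num)
      (by norm_num [cnull]) (by norm_num [cnull]) (Or.inl (by norm_num)) (Or.inr (Or.inl ⟨by norm_num, by norm_num⟩)) (Or.inl (by norm_num)) (by norm_num) (by norm_num) (by norm_num)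
      ((TriangleCap.core_ncard_triangles_le_cq3 M hfree hd).trans (by decide))
      ((S1.ncard_fourCircuits_le_fourCircuitBound M hfree hd).trans (by decide +kernel))
      ((Matroid.ncard_circuits_le_choose_of_encard M hd 4).trans (by decide +kernel))
      (Or.inl (tail_six_heavy_sq28C_20 p hp)) hR hn hfree (level_six_poly_heavy_sq28C_20 p hp)
  · exact c025_core_six_heavy_cell_sq28c M p 21 14 1 1 34 19 0 5106 1000 27 53130 2596 104
      (by norm_num) (by norm_num) (by norm_num) (by norm_num) (by norm_num) (by norm_num)
      (by norm_num [cnull]) (by norm_num [cnull]) (Or.inl (by norm_num)) (Or.inr (Or.inl ⟨by norm_num, by norm_num⟩)) (Or.inl (by norm_num)) (by norm_num) (by norm_num) (by norm_num)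
      ((TriangleCap.core_ncard_triangles_le_cq3 M hfree hd).trans (by decide))
      ((S1.ncard_fourCircuits_le_fourCircuitBound M hfree hd).trans (by decide +kernel))
      ((Matroid.ncard_circuits_le_choose_of_encard M hd 4).trans (by decide +kernel))
      (Or.inl (tail_six_heavy_sq28C_21 p hp)) hR hn hfree (level_six_poly_heavy_sq28C_21 p hp)
  · exact c025_core_six_heavy_cell_sq28c M p 22 15 1 1 35 0 0 4166 1000 28 65780 2970 117
      (by norm_num) (by norm_num) (by norm_num) (by norm_num) (by norm_num) (by norm_num)
      (by norm_num [cnull]) (by norm_num [cnull]) (Or.inl (by norm_num)) (Or.inr (Or.inr (by norm_num))) (Or.inl (by norm_num)) (by norm_num) (by norm_num) (by norm_num)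
      ((TriangleCap.core_ncard_triangles_le_cq3 M hfree hd).trans (by decide))
      ((S1.ncard_fourCircuits_le_fourCircuitBound M hfree hd).trans (by decide +kernel))
      ((Matroid.ncard_circuits_le_choose_of_encard M hd 4).trans (by decide +kernel))
      (Or.inl (tail_six_heavy_sq28C_22 p hp)) hR hn hfree (level_six_poly_heavy_sq28C_22 p hp)
  · exact c025_core_six_heavy_cell_sq28c M p 23 16 1 1 36 0 1 3472 1000 29 80730 3378 131
      (by norm_num) (by norm_num) (by norm_num) (by norm_num) (by norm_num) (by norm_num)
      (by norm_num [cnull]) (by norm_num [cnull]) (Or.inl (by norm_num)) (Or.inr (Or.inr (by norm_num))) (Or.inr rfl) (by norm_num) (by norm_num) (by norm_num)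
      ((TriangleCap.core_ncard_triangles_le_cq3 M hfree hd).trans (by decide))
      ((S1.ncard_fourCircuits_le_fourCircuitBound M hfree hd).trans (by decide +kernel))
      ((Matroid.ncard_circuits_le_choose_of_encard M hd 4).trans (by decide +kernel))
      (Or.inl (tail_six_heavy_sq28C_23 p hp)) hR hn hfree (level_six_poly_heavy_sq28C_23 p hp)
  · exact c025_core_six_heavy_cell_sq28c M p 24 17 1 1 37 0 1 2950 1000 30 98280 3822 146
      (by norm_num) (by norm_num) (by norm_num) (by norm_num) (by norm_num) (by norm_num)
      (by norm_num [cnull]) (by norm_num [cnull]) (Or.inl (by norm_num)) (Or.inr (Or.inr (by norm_num))) (Or.inr rfl) (by norm_num) (by norm_num) (by norm_num)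
      ((TriangleCap.core_ncard_triangles_le_cq3 M hfree hd).trans (by decide))
      ((S1.ncard_fourCircuits_le_fourCircuitBound M hfree hd).trans (by decide +kernel))
      ((Matroid.ncard_circuits_le_choose_of_encard M hd 4).trans (by decide +kernel))
      (Or.inl (tail_six_heavy_sq28C_24 p hp)) hR hn hfree (level_six_poly_heavy_sq28C_24 p hp)
  · exact c025_core_six_heavy_cell_sq28c M p 25 18 1 1 38 0 1 2551 1000 31 118755 4303 162
      (by norm_num) (by norm_num) (by norm_num) (by norm_num) (by norm_num) (by norm_num)
      (by norm_num [cnull]) (by norm_num [cnull]) (Or.inl (by norm_num)) (Or.inr (Or.inr (by norm_num))) (Or.inr rfl) (by norm_num) (by norm_num) (by norm_num)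
      ((TriangleCap.core_ncard_triangles_le_cq3 M hfree hd).trans (by decide))
      ((S1.ncard_fourCircuits_le_fourCircuitBound M hfree hd).trans (by decide +kernel))
      ((Matroid.ncard_circuits_le_choose_of_encard M hd 4).trans (by decide +kernel))
      (Or.inl (tail_six_heavy_sq28C_25 p hp)) hR hn hfree (level_six_poly_heavy_sq28C_25 p hp)
  · exact c025_core_six_heavy_cell_sq28c M p 26 19 1 1 39 0 1 2242 1000 32 142506 4823 179
      (by norm_num) (by norm_num) (by norm_num) (by norm_num) (by norm_num) (by norm_num)
      (by norm_num [cnull]) (by norm_num [cnull]) (Or.inl (by norm_num)) (Or.inr (Or.inr (by norm_num))) (Or.inr rfl) (by norm_num) (by norm_num) (by norm_num)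
      ((TriangleCap.core_ncard_triangles_le_cq3 M hfree hd).trans (by decide))
      ((S1.ncard_fourCircuits_le_fourCircuitBound M hfree hd).trans (by decide +kernel))
      ((Matroid.ncard_circuits_le_choose_of_encard M hd 4).trans (by decide +kernel))
      (Or.inl (tail_six_heavy_sq28C_26 p hp)) hR hn hfree (level_six_poly_heavy_sq28C_26 p hp)
  · exact c025_core_six_heavy_cell_sq28c M p 27 21 1 1 33 0 1 1999 1000 33 169911 5383 197
      (by norm_num) (by norm_num) (by norm_num) (by norm_num) (by norm_num) (by norm_num)
      (by norm_num [cnull]) (by norm_num [cnull]) (Or.inr ⟨by norm_num, by norm_num⟩) (Or.inr (Or.inr (by norm_num))) (Or.inr rfl) (by norm_num) (by norm_num) (by norm_num)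
      ((TriangleCap.core_ncard_triangles_le_cq3 M hfree hd).trans (by decide))
      ((S1.ncard_fourCircuits_le_fourCircuitBound M hfree hd).trans (by decide +kernel))
      ((Matroid.ncard_circuits_le_choose_of_encard M hd 4).trans (by decide +kernel))
      (Or.inl (tail_six_heavy_sq28C_27 p hp)) hR hn hfree (level_six_poly_heavy_sq28C_27 p hp)
  · exact c025_core_six_heavy_cell_sq28c M p 28 22 1 1 34 0 1 1808 1000 34 201376 5985 216
      (by norm_num) (by norm_num) (by norm_num) (by norm_num) (by norm_num) (by norm_num)
      (by norm_num [cnull]) (by norm_num [cnull]) (Or.inr ⟨by norm_num, by norm_num⟩) (Or.inr (Or.inr (by norm_num))) (Or.inr rfl) (by norm_num) (by norm_num) (by norm_num)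
      ((TriangleCap.core_ncard_triangles_le_cq3 M hfree hd).trans (by decide))
      ((S1.ncard_fourCircuits_le_fourCircuitBound M hfree hd).trans (by decide +kernel))
      ((Matroid.ncard_circuits_le_choose_of_encard M hd 4).trans (by decide +kernel))
      (Or.inl (tail_six_heavy_sq28C_28 p hp)) hR hn hfree (level_six_poly_heavy_sq28C_28 p hp)
  · exact c025_core_six_heavy_cell_sq28c M p 29 22 1 1 35 0 1 1654 1000 35 237336 6630 236
      (by norm_num) (by norm_num) (by norm_num) (by norm_num) (by norm_num) (by norm_num)
      (by norm_num [cnull]) (by norm_num [cnull]) (Or.inr ⟨by norm_num, by norm_num⟩) (Or.inr (Or.inr (by norm_num))) (Or.inr rfl) (by norm_num) (by norm_num) (by norm_num)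
      ((TriangleCap.core_ncard_triangles_le_cq3 M hfree hd).trans (by decide))
      ((S1.ncard_fourCircuits_le_fourCircuitBound M hfree hd).trans (by decide +kernel))
      ((Matroid.ncard_circuits_le_choose_of_encard M hd 4).trans (by decide +kernel))
      (Or.inl (tail_six_heavy_sq28C_29 p hp)) hR hn hfree (level_six_poly_heavy_sq28C_29 p hp)
  · exact c025_core_six_heavy_cell_sq28c M p 30 23 1 1 36 0 1 1531 1000 36 278256 7320 408
      (by norm_num) (by norm_num) (by norm_num) (by norm_num) (by norm_num) (by norm_num)
      (by norm_num [cnull]) (by norm_num [cnull]) (Or.inr ⟨by norm_num, by norm_num⟩) (Or.inr (Or.inr (by norm_num))) (Or.inr rfl) (by norm_num) (by norm_num) (by norm_num)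
      ((S1.ncard_triangles_le_of_nullity_sharp M hC1 hC2 (by omega) hd).trans (by norm_num))
      ((S1.ncard_fourCircuits_le_fourCircuitBound M hfree hd).trans (by decide +kernel))
      ((Matroid.ncard_circuits_le_choose_of_encard M hd 4).trans (by decide +kernel))
      (Or.inl (tail_six_heavy_sq28C_30 p hp)) hR hn hfree (level_six_poly_heavy_sq28C_30 p hp)
  · exact c025_core_six_heavy_cell_sq28c M p 31 23 1 1 37 0 1 1431 1000 37 324632 8056 437
      (by norm_num) (by norm_num) (by norm_num) (by norm_num) (by norm_num) (by norm_num)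
      (by norm_num [cnull]) (by norm_num [cnull]) (Or.inr ⟨by norm_num, by norm_num⟩) (Or.inr (Or.inr (by norm_num))) (Or.inr rfl) (by norm_num) (by norm_num) (by norm_num)
      ((S1.ncard_triangles_le_of_nullity_sharp M hC1 hC2 (by omega) hd).trans (by norm_num))
      ((S1.ncard_fourCircuits_le_fourCircuitBound M hfree hd).trans (by decide +kernel))
      ((Matroid.ncard_circuits_le_choose_of_encard M hd 4).trans (by decide +kernel))
      (Or.inl (tail_six_heavy_sq28C_31 p hp)) hR hn hfree (level_six_poly_heavy_sq28C_31 p hp)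


end ThmN

end PercRepro
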